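import Literature.MathematicalPhysics.KineticTheory.LambertianHardSphereFlow
import HarnessLib

/-!
# Almost-sure non-degeneracy of the Lambertian redraw under Gaussian noise

The Lambertian (cosine-law) hard-sphere dynamics of
`Literature.MathematicalPhysics.KineticTheory.LambertianHardSphereFlow` redraws the outgoing
relative velocity of a colliding pair along `lambertDir ω ξ = normalize(ω̂ + ξ̂)`, `ω` the contact
normal, `ξ` a standard Gaussian vector. That file documents the junk case `lambertDir ω ξ = 0`
(the bisector `ω̂ + ξ̂` vanishes: `ξ ≠ 0` antiparallel to `ω`) in which the pair loses its
relative kinetic energy, and proves conservation of energy / the outgoing property *off* it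
(`configEnergy_lambertPair`, `configEnergy_lambertStep`, `isOutgoing_lambertPair`).

This file proves that the junk case is a **null event for Gaussian noise** in dimension `≥ 2`,
i.e. the elementary "the redrawn direction is almost surely a unit vector of the *open* outgoing
hemisphere" (Comets–Popov–Schütz–Vachkovskaia 2008 §2.1: the cosine reflection law is a
probability density on the open hemisphere `{n · ω > 0}` of the unit sphere), and threads it to
the pair redraw and to one collision step:

* `inner_lambertDir_pos` — deterministic: off the junk case, `⟪ω, lambertDir ω ξ⟫ > 0`
  (strictly into the gas side, never grazing);
* `stdGaussian_inner_eq_const` — a level set `{⟪u, ·⟫ = a}` of a nonzero linear form is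
  `stdGaussian`-null (its law is the non-degenerate `gaussianReal 0 ‖u‖²`);
* `stdGaussian_lambertDir_eq_zero`, `ae_stdGaussian_lambertDir_ne_zero`,
  `ae_stdGaussian_norm_lambertDir`, `ae_stdGaussian_inner_lambertDir_pos` — for `ω ≠ 0` and
  `1 < finrank ℝ E`: almost surely `‖lambertDir ω ξ‖ = 1` and `⟪ω, lambertDir ω ξ⟫ > 0`;
* `ae_stdGaussian_configEnergy_lambertPair`, `ae_stdGaussian_isOutgoing_lambertPair`,
  `ae_stdGaussian_configEnergy_lambertStep`, `integral_configEnergy_lambertStep` — for every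
  pair (resp. every datum and one Lambertian step) the kinetic energy is conserved for
  `stdGaussian`-a.e. noise, and a redrawn pair with nonzero separation vector and relative
  velocity is outgoing a.s.;
* `ae_lambertNoise_forall_stateAfter_notMem` — the **fresh-noise lemma** for the recursion
  driven by `ξs ∼ lambertNoise`: a measurable property of `(state, noise)` failing only on a
  `stdGaussian`-null set of noises for every state holds a.s. for `(z_k, ξs k)`, all `k`
  (restart identity `lambertStateAfter_succ_eq_tail` + Fubini over `lambertNoise_map_headTail`,
  induction on `k` uniformly in the datum; regular measurable geometry);
* `ae_lambertNoise_forall_lambertDir_ne_zero`, `ae_lambertNoise_forall_configEnergy_lambertStateAfter`,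
  `ae_lambertNoise_forall_configEnergy_lambertFlow` (+ `_torus`, `_hsDiameter`) — for every
  datum, almost surely all redraws of the recursion are non-degenerate and the kinetic energy is
  conserved along the recursion and along the flow at all times.

## Mathlib / Literature reuse

`ProbabilityTheory.stdGaussian`, `IsGaussian.map_eq_gaussianReal` (the law of a continuous
linear form under a Gaussian measure), `variance_dual_stdGaussian`, `nullSingletonClass_gaussianReal`,
`Measure.measure_prod_null`, `Measure.infinitePi_map_eval` are Mathlib's; everything Lambertian
(and `measurable_lambertStateAfter`, `lambertNoise_map_headTail`) is `LambertianHardSphereFlow`'s.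
Nothing is redefined; no named fact is introduced.

## Not here

The `liouville ⊗ lambertNoise`-almost-sure *well-posedness* of the Lambertian flow (simple
incoming collisions only, no grazing touch inside free flights, no accumulation of collision
instants) and its measure preservation — the route item `LambertianWellPosed`; this file gives
the noise-side input (fresh noise, non-degenerate redraws), not the configuration-side geometry.

## References

* F. Comets, S. Popov, G. M. Schütz, M. Vachkovskaia, *Billiards in a general domain with random
  reflections*, Arch. Ration. Mech. Anal. 191 (2008) 497–537, §2.1.
* R. Feres, G. Yablonsky, *Knudsen's cosine law and random billiards*, Chem. Eng. Sci. 59 (2004)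
  1541–1556.
-/

noncomputable section

open MeasureTheory ProbabilityTheory Set Function Filter
open scoped ENNReal InnerProductSpace

namespace Literature.MathematicalPhysics.KineticTheory

open Literature.Analysis.FluidPDE Literature.Analysis.FluidPDE.Alexander

/-! ## Deterministic complements on the Lambertian direction -/

section Dir

variable {E : Type*} [NormedAddCommGroup E] [InnerProductSpace ℝ E]

/-- **Off the junk case the redrawn direction points strictly into the gas side**:
if `ω ≠ 0` and `lambertDir ω ξ ≠ 0` then `⟪ω, lambertDir ω ξ⟫ > 0` (the value `0`, a grazing
redraw, would force `ξ̂ = -ω̂`, i.e. the junk case). [folklore] -/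
theorem inner_lambertDir_pos {ω ξ : E} (hω : ω ≠ 0) (h : lambertDir ω ξ ≠ 0) :
    0 < ⟪ω, lambertDir ω ξ⟫_ℝ := by
  have hω' : ‖ω‖ ≠ 0 := norm_ne_zero_iff.2 hω
  have hb0 : ‖ω‖⁻¹ • ω + ‖ξ‖⁻¹ • ξ ≠ 0 := fun h0 => h (lambertDir_eq_zero_iff.2 h0)
  rw [lambertDir, inner_smul_right]
  refine mul_pos (inv_pos.2 (norm_pos_iff.2 hb0)) (lt_of_le_of_ne (inner_bisector_nonneg ω ξ) ?_)
  intro h0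
  apply hb0
  -- `⟪ω, ω̂ + ξ̂⟫ = 0` forces `⟪ω̂, ξ̂⟫ = -1`, hence `‖ω̂ + ξ̂‖² = ‖ξ̂‖² - 1 ≤ 0`.
  have hu : ‖‖ω‖⁻¹ • ω‖ = 1 := by
    rw [norm_smul, norm_inv, norm_norm, inv_mul_cancel₀ hω']
  have hv : ‖‖ξ‖⁻¹ • ξ‖ ≤ 1 := by
    rw [norm_smul, norm_inv, norm_norm]
    by_cases hξ : ‖ξ‖ = 0
    · rw [hξ, mul_zero]; exact zero_le_one
    · rw [inv_mul_cancel₀ hξ]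
  have hcross : ⟪‖ω‖⁻¹ • ω, ‖ξ‖⁻¹ • ξ⟫_ℝ = -1 := by
    have h1 : ⟪‖ω‖⁻¹ • ω, ‖ω‖⁻¹ • ω + ‖ξ‖⁻¹ • ξ⟫_ℝ = 0 := by
      rw [real_inner_smul_left, ← h0, mul_zero]
    rw [inner_add_right, real_inner_self_eq_norm_sq, hu, one_pow] at h1
    linarith
  have e := norm_add_sq_real (‖ω‖⁻¹ • ω) (‖ξ‖⁻¹ • ξ)
  rw [hu, hcross, one_pow] at e
  have hv2 : ‖‖ξ‖⁻¹ • ξ‖ ^ 2 ≤ 1 := by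
    have := norm_nonneg (‖ξ‖⁻¹ • ξ)
    nlinarith
  have hsq : ‖‖ω‖⁻¹ • ω + ‖ξ‖⁻¹ • ξ‖ ^ 2 ≤ 0 := by linarith
  have hn : ‖‖ω‖⁻¹ • ω + ‖ξ‖⁻¹ • ξ‖ = 0 :=
    le_antisymm (by nlinarith [norm_nonneg (‖ω‖⁻¹ • ω + ‖ξ‖⁻¹ • ξ)]) (norm_nonneg _)
  exact norm_eq_zero.1 hn

/-- Off the junk case, for `ω ≠ 0`, the Lambertian direction is a **unit vector of the open
hemisphere about `ω`**. [folklore] -/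
theorem norm_lambertDir_eq_one_and_inner_pos {ω ξ : E} (hω : ω ≠ 0) (h : lambertDir ω ξ ≠ 0) :
    ‖lambertDir ω ξ‖ = 1 ∧ 0 < ⟪ω, lambertDir ω ξ⟫_ℝ :=
  ⟨norm_lambertDir h, inner_lambertDir_pos hω h⟩

/-- **The junk case lies on the line of `ω`**: if `lambertDir ω ξ = 0` then `ξ` is orthogonal
to every vector orthogonal to `ω`. [folklore] -/
theorem inner_eq_zero_of_lambertDir_eq_zero {ω ξ u : E} (hu : ⟪u, ω⟫_ℝ = 0)
    (h : lambertDir ω ξ = 0) : ⟪u, ξ⟫_ℝ = 0 := by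
  rw [lambertDir_eq_zero_iff] at h
  have h1 : ⟪u, ‖ω‖⁻¹ • ω + ‖ξ‖⁻¹ • ξ⟫_ℝ = 0 := by rw [h, inner_zero_right]
  rw [inner_add_right, real_inner_smul_right, real_inner_smul_right, hu, mul_zero, zero_add]
    at h1
  rcases mul_eq_zero.1 h1 with h2 | h2
  · rw [inv_eq_zero, norm_eq_zero] at h2
    rw [h2, inner_zero_right]
  · exact h2

end Dir

/-! ## Gaussian noise: the junk case is a null event -/

section Gaussian

variable {E : Type*} [NormedAddCommGroup E] [InnerProductSpace ℝ E] [FiniteDimensional ℝ E]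
  [MeasurableSpace E] [BorelSpace E]

/-- **A level set of a nonzero linear form is `stdGaussian`-null**: for `u ≠ 0` and any `a`,
`stdGaussian E {ξ | ⟪u, ξ⟫ = a} = 0` — the law of `⟪u, ·⟫` under the standard Gaussian is the
non-degenerate real Gaussian `N(0, ‖u‖²)`, which has no atoms. [folklore] -/
theorem stdGaussian_inner_eq_const {u : E} (hu : u ≠ 0) (a : ℝ) :
    stdGaussian E {ξ | ⟪u, ξ⟫_ℝ = a} = 0 := by
  set L : StrongDual ℝ E := innerSL ℝ u with hL
  have hmap : (stdGaussian E).map L = gaussianReal 0 (‖u‖ ^ 2).toNNReal := by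
    rw [IsGaussian.map_eq_gaussianReal L, integral_strongDual_stdGaussian,
      variance_dual_stdGaussian, hL, innerSL_apply_norm]
  have hv : (‖u‖ ^ 2).toNNReal ≠ 0 :=
    (Real.toNNReal_pos.2 (by positivity : 0 < ‖u‖ ^ 2)).ne'
  have hset : {ξ : E | ⟪u, ξ⟫_ℝ = a} = L ⁻¹' {a} := by
    ext ξ
    simp [hL]
  haveI := nullSingletonClass_gaussianReal (μ := 0) hv
  rw [hset, ← Measure.map_apply L.continuous.measurable (measurableSet_singleton a), hmap,
    measure_singleton]

omit [MeasurableSpace E] [BorelSpace E] in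
/-- In dimension `≥ 2` there is a nonzero vector orthogonal to any given vector. [folklore] -/
theorem exists_ne_zero_inner_eq_zero (hE : 1 < Module.finrank ℝ E) (ω : E) :
    ∃ u : E, u ≠ 0 ∧ ⟪u, ω⟫_ℝ = 0 := by
  by_cases hω : ω = 0
  · obtain ⟨u, hu⟩ := (Module.finrank_pos_iff_exists_ne_zero (R := ℝ) (M := E)).1 (by omega)
    exact ⟨u, hu, by rw [hω, inner_zero_right]⟩
  have hne : (ℝ ∙ ω)ᗮ ≠ ⊥ := by
    intro hbot
    rw [Submodule.orthogonal_eq_bot_iff] at hbot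
    have h1 : Module.finrank ℝ (ℝ ∙ ω) = 1 := finrank_span_singleton hω
    rw [hbot, finrank_top] at h1
    omega
  obtain ⟨u, hu, hu0⟩ := (Submodule.ne_bot_iff _).1 hne
  exact ⟨u, hu0, Submodule.mem_orthogonal_singleton_iff_inner_left.1 hu⟩

/-- **The junk case of the Lambertian direction is Gaussian-null**: in dimension `≥ 2`, for
every `ω`, `stdGaussian E {ξ | lambertDir ω ξ = 0} = 0` (the junk set lies on the line `ℝ ω` —
it is `{0}` if `ω = 0` —, inside a level set of a nonzero linear form). In dimension `1` this
fails for `ω ≠ 0` (the event has mass `1/2`). [folklore] -/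
theorem stdGaussian_lambertDir_eq_zero (hE : 1 < Module.finrank ℝ E) (ω : E) :
    stdGaussian E {ξ | lambertDir ω ξ = 0} = 0 := by
  obtain ⟨u, hu0, huω⟩ := exists_ne_zero_inner_eq_zero hE ω
  exact measure_mono_null (fun ξ hξ => inner_eq_zero_of_lambertDir_eq_zero huω hξ)
    (stdGaussian_inner_eq_const hu0 0)

/-- **Almost surely the Lambertian direction is non-degenerate** (any `ω`, dimension `≥ 2`).
[folklore] -/
theorem ae_stdGaussian_lambertDir_ne_zero (hE : 1 < Module.finrank ℝ E) (ω : E) :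
    ∀ᵐ ξ ∂(stdGaussian E), lambertDir ω ξ ≠ 0 := by
  rw [ae_iff]
  simpa only [not_not] using stdGaussian_lambertDir_eq_zero hE ω

/-- **Almost surely the Lambertian direction is a unit vector** (any `ω`, dimension `≥ 2`).
[folklore] -/
theorem ae_stdGaussian_norm_lambertDir (hE : 1 < Module.finrank ℝ E) (ω : E) :
    ∀ᵐ ξ ∂(stdGaussian E), ‖lambertDir ω ξ‖ = 1 :=
  (ae_stdGaussian_lambertDir_ne_zero hE ω).mono fun _ h => norm_lambertDir h

/-- **Almost surely the Lambertian direction lies in the open hemisphere about `ω`**: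
`⟪ω, lambertDir ω ξ⟫ > 0` for `stdGaussian`-a.e. `ξ` (`ω ≠ 0`, dimension `≥ 2`) — the cosine
law charges the open outgoing hemisphere only (Comets–Popov–Schütz–Vachkovskaia 2008 §2.1).
[cite: CometsEtAl2008, §2.1] -/
theorem ae_stdGaussian_inner_lambertDir_pos (hE : 1 < Module.finrank ℝ E) {ω : E} (hω : ω ≠ 0) :
    ∀ᵐ ξ ∂(stdGaussian E), 0 < ⟪ω, lambertDir ω ξ⟫_ℝ :=
  (ae_stdGaussian_lambertDir_ne_zero hE ω).mono fun _ h => inner_lambertDir_pos hω h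

/-- Combined form: almost surely `lambertDir ω ξ` is a unit vector of the open hemisphere
`{n | ‖n‖ = 1, ⟪ω, n⟫ > 0}`. [folklore] -/
theorem ae_stdGaussian_lambertDir_mem_openHemisphere (hE : 1 < Module.finrank ℝ E) {ω : E}
    (hω : ω ≠ 0) :
    ∀ᵐ ξ ∂(stdGaussian E), ‖lambertDir ω ξ‖ = 1 ∧ 0 < ⟪ω, lambertDir ω ξ⟫_ℝ :=
  (ae_stdGaussian_lambertDir_ne_zero hE ω).mono fun _ h =>
    norm_lambertDir_eq_one_and_inner_pos hω h

end Gaussian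

/-! ## The Euclidean velocity space `ℝ^d`, `d ≥ 2` -/

section Euclidean

variable {d : Type*} [Fintype d] [Nontrivial d]

/-- `ℝ^d` has dimension `> 1` as soon as `d` has two elements. [folklore] -/
theorem one_lt_finrank_euclideanSpace : 1 < Module.finrank ℝ (EuclideanSpace ℝ d) := by
  rw [finrank_euclideanSpace]
  exact Fintype.one_lt_card_iff_nontrivial.2 ‹_›

/-- Almost surely the Lambertian direction in `ℝ^d`, `d ≥ 2`, is non-degenerate (any `ω`).
[folklore] -/
theorem ae_stdGaussian_lambertDir_ne_zero_euclideanSpace (ω : EuclideanSpace ℝ d) :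
    ∀ᵐ ξ ∂(stdGaussian (EuclideanSpace ℝ d)), lambertDir ω ξ ≠ 0 :=
  ae_stdGaussian_lambertDir_ne_zero (E := EuclideanSpace ℝ d) one_lt_finrank_euclideanSpace ω

/-- Almost surely the Lambertian direction in `ℝ^d`, `d ≥ 2`, is a unit vector of the open
hemisphere about `ω ≠ 0`. [folklore] -/
theorem ae_stdGaussian_lambertDir_mem_openHemisphere_euclideanSpace {ω : EuclideanSpace ℝ d}
    (hω : ω ≠ 0) :
    ∀ᵐ ξ ∂(stdGaussian (EuclideanSpace ℝ d)), ‖lambertDir ω ξ‖ = 1 ∧ 0 < ⟪ω, lambertDir ω ξ⟫_ℝ :=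
  ae_stdGaussian_lambertDir_mem_openHemisphere (E := EuclideanSpace ℝ d)
    one_lt_finrank_euclideanSpace hω

end Euclidean

/-! ## Consequences for the pair redraw and for one collision step -/

section Contact

variable {d : Type*} [Fintype d] {X : Type*} {N : ℕ} {G : Geometry d X} {i j : Fin N} {ε : ℝ}

/-- A pair in contact at diameter `ε ≠ 0` has a nonzero separation vector. [folklore] -/
theorem sepVec_ne_zero_of_mem_contactSet (hε : ε ≠ 0) {z : Config N d X}
    (hz : z ∈ contactSet G N ε i j) : G.sepVec (z i).1 (z j).1 ≠ 0 := by
  intro h0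
  apply hε
  rw [← (mem_contactSet.1 hz).2, h0, norm_zero]

end Contact

section Pair

variable {d : Type*} [Fintype d] [Nontrivial d] {X : Type*} {N : ℕ} {G : Geometry d X}
  {i j : Fin N}

/-- **The Lambertian redraw conserves the kinetic energy for almost every noise** (any pair
`i ≠ j`, dimension `≥ 2`; no hypothesis on the separation vector: for `ω = 0` the redrawn
direction is `ξ̂`, still a unit vector a.s.). [folklore] -/
theorem ae_stdGaussian_configEnergy_lambertPair (hij : i ≠ j) (z : Config N d X) :
    ∀ᵐ ξ ∂(stdGaussian (EuclideanSpace ℝ d)),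
      configEnergy (lambertPair G i j z ξ) = configEnergy z := by
  filter_upwards [ae_stdGaussian_lambertDir_ne_zero_euclideanSpace
    (G.sepVec (z i).1 (z j).1)] with ξ h
  exact configEnergy_lambertPair hij z ξ (Or.inl h)

/-- The Lambertian redraw preserves the relative speed of the pair for almost every noise.
[folklore] -/
theorem ae_stdGaussian_norm_vel_sub_vel_lambertPair (hij : i ≠ j) (z : Config N d X) :
    ∀ᵐ ξ ∂(stdGaussian (EuclideanSpace ℝ d)),
      ‖(lambertPair G i j z ξ i).2 - (lambertPair G i j z ξ j).2‖ = ‖(z i).2 - (z j).2‖ := by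
  filter_upwards [ae_stdGaussian_lambertDir_ne_zero_euclideanSpace
    (G.sepVec (z i).1 (z j).1)] with ξ h
  exact norm_vel_sub_vel_lambertPair hij z ξ h

/-- **The redrawn pair is outgoing for almost every noise** (nonzero separation vector and
nonzero relative velocity): `⟪ω, v_i' - v_j'⟫ = ‖g‖ ⟪ω, n⟫ > 0` a.s. — after a Lambertian
collision the pair separates, it never grazes or re-enters. [folklore] -/
theorem ae_stdGaussian_isOutgoing_lambertPair (hij : i ≠ j) {z : Config N d X}
    (hω : G.sepVec (z i).1 (z j).1 ≠ 0) (hv : (z i).2 ≠ (z j).2) :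
    ∀ᵐ ξ ∂(stdGaussian (EuclideanSpace ℝ d)), IsOutgoing G (lambertPair G i j z ξ) i j := by
  filter_upwards [ae_stdGaussian_lambertDir_mem_openHemisphere_euclideanSpace hω] with ξ h
  exact isOutgoing_lambertPair hij hv h.2.ne'

variable {ε : ℝ}

/-- For almost every noise, the Lambertian direction is non-degenerate simultaneously for
**every pair** of a configuration (finitely many pairs), in particular for every incoming
contact pair. [folklore] -/
theorem ae_stdGaussian_forall_lambertDir_ne_zero (w : Config N d X) :
    ∀ᵐ ξ ∂(stdGaussian (EuclideanSpace ℝ d)),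
      ∀ p : Fin N × Fin N, lambertDir (G.sepVec (w p.1).1 (w p.2).1) ξ ≠ 0 :=
  ae_all_iff.2 fun p => ae_stdGaussian_lambertDir_ne_zero_euclideanSpace (G.sepVec (w p.1).1 (w p.2).1)

/-- **One Lambertian collision step conserves the kinetic energy for almost every noise**
(any datum `z`, any diameter; dimension `≥ 2`). [folklore] -/
theorem ae_stdGaussian_configEnergy_lambertStep (z : Config N d X) :
    ∀ᵐ ξ ∂(stdGaussian (EuclideanSpace ℝ d)),
      configEnergy (lambertStep G ε ξ z) = configEnergy z := by
  filter_upwards [ae_stdGaussian_forall_lambertDir_ne_zero (G := G)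
    (freeFlight G (freeExitTime G ε z).toReal z)] with ξ h
  exact configEnergy_lambertStep ξ z fun p _ => h p

/-- Integrated form: the mean kinetic energy after one Lambertian step equals the kinetic
energy before it (`stdGaussian` is a probability measure and the integrand is a.e. constant).
[folklore] -/
theorem integral_configEnergy_lambertStep (z : Config N d X) :
    ∫ ξ, configEnergy (lambertStep G ε ξ z) ∂(stdGaussian (EuclideanSpace ℝ d)) =
      configEnergy z := by
  rw [integral_congr_ae (ae_stdGaussian_configEnergy_lambertStep z), integral_const,
    smul_eq_mul, probReal_univ, one_mul]

end Pair

/-! ## Along the whole recursion: fresh noise, and all redraws non-degenerate almost surely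

For a *fixed* datum `z` and the driving noise `ξs ∼ lambertNoise = γ^ℕ`, the `k`-th redraw uses
`ξs k`, which is independent of the state `z_k` (a function of `ξs 0, …, ξs (k-1)`): if for
every state `w` a property of the pair `(w, ξ)` fails only on a `γ`-null set of noises `ξ`, then
almost surely it holds for `(z_k, ξs k)` for every `k` (`ae_lambertNoise_forall_stateAfter_notMem`,
the **fresh-noise lemma**). The proof is the restart identity `lambertStateAfter_succ_eq_tail`
plus Fubini through the head/tail decomposition `lambertNoise_map_headTail`, by induction on `k`
uniformly in `z`; measurability of the states (`measurable_lambertStateAfter`) is where the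
regular measurable geometry enters. Applied to the degenerate-redraw set it gives: all redraws
are non-degenerate, and the kinetic energy is conserved along the recursion and the flow,
almost surely. -/

section Recursion

variable {d : Type*} [Fintype d] {X : Type*} {N : ℕ} [TopologicalSpace X] [MeasurableSpace X]
  {G : Geometry d X} {ε : ℝ}

/-- The `k`-th state of the Lambertian recursion, of measurable arguments, is measurable
(regular measurable geometry; compositional form of `measurable_lambertStateAfter`, proved
the same way, by induction on `k` from `measurable_lambertStep_comp`). [folklore] -/
theorem measurable_lambertStateAfter_comp {α : Type*} [MeasurableSpace α]
    (hG : G.IsHardSphereRegular ε) (hGm : G.IsMeasurable) {w : α → Config N d X}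
    (hw : Measurable w) {ξs : α → ℕ → EuclideanSpace ℝ d} (hξs : Measurable ξs) (k : ℕ) :
    Measurable fun a => lambertStateAfter G ε (ξs a) (w a) k := by
  -- (`(measurable_lambertStateAfter …).comp (hw.prodMk hξs)` is a runaway `isDefEq`; induct.)
  induction k with
  | zero => simpa only [lambertStateAfter_zero] using hw
  | succ k ih =>
    simp only [lambertStateAfter_succ]
    exact measurable_lambertStep_comp hG hGm ih ((measurable_pi_apply k).comp hξs)

/-- **Fresh-noise lemma** (measure form): if `D ⊆ Config × ℝ^d` is measurable with
`stdGaussian`-null sections `{ξ | (w, ξ) ∈ D}` for *every* state `w`, then for every datum `z`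
and every `k`, `lambertNoise {ξs | (z_k(z, ξs), ξs k) ∈ D} = 0` (regular measurable geometry).
Induction on `k` uniformly in `z`: `k = 0` is `lambertNoise ∘ (ξs ↦ ξs 0)⁻¹ = stdGaussian`; the
step is the restart identity and Fubini over `lambertNoise ≅ stdGaussian ⊗ lambertNoise`.
[folklore] -/
theorem lambertNoise_stateAfter_mem_eq_zero (hG : G.IsHardSphereRegular ε) (hGm : G.IsMeasurable)
    {D : Set (Config N d X × EuclideanSpace ℝ d)} (hD : MeasurableSet D)
    (hnull : ∀ w : Config N d X, stdGaussian (EuclideanSpace ℝ d) (Prod.mk w ⁻¹' D) = 0)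
    (k : ℕ) (z : Config N d X) :
    lambertNoise d {ξs | (lambertStateAfter G ε ξs z k, ξs k) ∈ D} = 0 := by
  induction k generalizing z with
  | zero =>
    have hmap : (lambertNoise d).map (fun ξs : ℕ → EuclideanSpace ℝ d => ξs 0) =
        stdGaussian (EuclideanSpace ℝ d) :=
      Measure.infinitePi_map_eval (fun _ : ℕ => stdGaussian (EuclideanSpace ℝ d)) 0
    have hset : {ξs : ℕ → EuclideanSpace ℝ d | (lambertStateAfter G ε ξs z 0, ξs 0) ∈ D} =
        (fun ξs : ℕ → EuclideanSpace ℝ d => ξs 0) ⁻¹' (Prod.mk z ⁻¹' D) := by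
      ext ξs
      simp only [mem_setOf_eq, mem_preimage, lambertStateAfter_zero]
    have h1 := Measure.le_map_apply (μ := lambertNoise d)
      (measurable_pi_apply (X := fun _ : ℕ => EuclideanSpace ℝ d) 0).aemeasurable (Prod.mk z ⁻¹' D)
    rw [hmap, hnull z] at h1
    rw [hset]
    exact nonpos_iff_eq_zero.1 h1
  | succ k ih =>
    -- the level-`k` set of the recursion restarted at `lambertStep ξ₀ z`, as a set of `(ξ₀, ξ')`
    have hΨ₁ : Measurable fun q : EuclideanSpace ℝ d × (ℕ → EuclideanSpace ℝ d) =>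
        lambertStateAfter G ε q.2 (lambertStep G ε q.1 z) k :=
      measurable_lambertStateAfter_comp hG hGm
        (measurable_lambertStep_comp hG hGm measurable_const measurable_fst) measurable_snd k
    have hΨ : Measurable fun q : EuclideanSpace ℝ d × (ℕ → EuclideanSpace ℝ d) =>
        (lambertStateAfter G ε q.2 (lambertStep G ε q.1 z) k, q.2 k) :=
      hΨ₁.prodMk ((measurable_pi_apply (X := fun _ : ℕ => EuclideanSpace ℝ d) k).comp
        measurable_snd)
    have hT0 : ((stdGaussian (EuclideanSpace ℝ d)).prod (lambertNoise d))
        ((fun q : EuclideanSpace ℝ d × (ℕ → EuclideanSpace ℝ d) =>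
          (lambertStateAfter G ε q.2 (lambertStep G ε q.1 z) k, q.2 k)) ⁻¹' D) = 0 := by
      rw [Measure.measure_prod_null (hD.preimage hΨ)]
      exact Eventually.of_forall fun ξ₀ => ih (lambertStep G ε ξ₀ z)
    -- restart: the level-`k+1` set of `z` is the pull-back of that set under head/tail
    have hsub : {ξs : ℕ → EuclideanSpace ℝ d | (lambertStateAfter G ε ξs z (k + 1), ξs (k + 1)) ∈ D} ⊆
        (fun ξs : ℕ → EuclideanSpace ℝ d => (ξs 0, fun m : ℕ => ξs (m + 1))) ⁻¹'
          ((fun q : EuclideanSpace ℝ d × (ℕ → EuclideanSpace ℝ d) =>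
            (lambertStateAfter G ε q.2 (lambertStep G ε q.1 z) k, q.2 k)) ⁻¹' D) := by
      intro ξs hξs
      rw [mem_setOf_eq, lambertStateAfter_succ_eq_tail] at hξs
      exact hξs
    have h1 := Measure.le_map_apply (μ := lambertNoise d)
      ((measurable_pi_apply (X := fun _ : ℕ => EuclideanSpace ℝ d) 0).prodMk
        (measurable_tail d)).aemeasurable
      ((fun q : EuclideanSpace ℝ d × (ℕ → EuclideanSpace ℝ d) =>
        (lambertStateAfter G ε q.2 (lambertStep G ε q.1 z) k, q.2 k)) ⁻¹' D)
    rw [lambertNoise_map_headTail, hT0] at h1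
    exact measure_mono_null hsub (nonpos_iff_eq_zero.1 h1)

/-- **Fresh-noise lemma** (almost-sure form): if for every state `w` the noises `ξ` with
`(w, ξ) ∈ D` form a `stdGaussian`-null set (`D` measurable), then for every datum `z`,
`lambertNoise`-almost surely `(z_k, ξs k) ∉ D` for every `k` — the `k`-th noise is fresh
relative to the `k`-th state. [folklore] -/
theorem ae_lambertNoise_forall_stateAfter_notMem (hG : G.IsHardSphereRegular ε)
    (hGm : G.IsMeasurable) {D : Set (Config N d X × EuclideanSpace ℝ d)} (hD : MeasurableSet D)
    (hnull : ∀ w : Config N d X, ∀ᵐ ξ ∂(stdGaussian (EuclideanSpace ℝ d)), (w, ξ) ∉ D)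
    (z : Config N d X) :
    ∀ᵐ ξs ∂(lambertNoise d), ∀ k, (lambertStateAfter G ε ξs z k, ξs k) ∉ D := by
  rw [ae_all_iff]
  intro k
  have h0 : ∀ w : Config N d X, stdGaussian (EuclideanSpace ℝ d) (Prod.mk w ⁻¹' D) = 0 :=
    fun w => measure_eq_zero_iff_ae_notMem.2 (hnull w)
  exact measure_eq_zero_iff_ae_notMem.1 (lambertNoise_stateAfter_mem_eq_zero hG hGm hD h0 k z)

/-- The set of `(state, noise)` pairs for which the noise gives the junk direction along the
separation vector of *some* pair of the exit configuration of the state (a superset of the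
degenerate redraws) is measurable, for a regular measurable geometry. [folklore] -/
theorem measurableSet_degenerateRedraw (hG : G.IsHardSphereRegular ε) (hGm : G.IsMeasurable) :
    MeasurableSet {q : Config N d X × EuclideanSpace ℝ d | ∃ p : Fin N × Fin N,
      lambertDir (G.sepVec (freeFlight G (freeExitTime G ε q.1).toReal q.1 p.1).1
        (freeFlight G (freeExitTime G ε q.1).toReal q.1 p.2).1) q.2 = 0} := by
  have hexit : Measurable fun w : Config N d X => freeFlight G (freeExitTime G ε w).toReal w :=
    hGm.measurable_freeFlight₂.comp ((measurable_freeExitTime hG hGm).ennreal_toReal.prodMk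
      measurable_id)
  simp only [setOf_exists]
  exact MeasurableSet.iUnion fun p =>
    (((hGm.measurable_sepVec_config p.1 p.2).comp (hexit.comp measurable_fst)).lambertDir
      measurable_snd) (measurableSet_singleton 0)

variable [Nontrivial d]

/-- **All redraws of the Lambertian recursion are non-degenerate, almost surely** (fixed datum
`z`, regular measurable geometry, dimension `≥ 2`): for `lambertNoise`-a.e. `ξs`, for every `k`
and every pair `p` of the `k`-th exit configuration (in particular its incoming contact pair),
the Lambertian direction along the pair's separation vector drawn with `ξs k` is nonzero. This
is the one-step input of the almost-sure well-posedness of the Lambertian flow. [folklore] -/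
theorem ae_lambertNoise_forall_lambertDir_ne_zero (hG : G.IsHardSphereRegular ε)
    (hGm : G.IsMeasurable) (z : Config N d X) :
    ∀ᵐ ξs ∂(lambertNoise d), ∀ (k : ℕ) (p : Fin N × Fin N),
      lambertDir (G.sepVec
        (freeFlight G (freeExitTime G ε (lambertStateAfter G ε ξs z k)).toReal
          (lambertStateAfter G ε ξs z k) p.1).1
        (freeFlight G (freeExitTime G ε (lambertStateAfter G ε ξs z k)).toReal
          (lambertStateAfter G ε ξs z k) p.2).1) (ξs k) ≠ 0 := by
  have hnull : ∀ w : Config N d X, ∀ᵐ ξ ∂(stdGaussian (EuclideanSpace ℝ d)),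
      (w, ξ) ∉ {q : Config N d X × EuclideanSpace ℝ d | ∃ p : Fin N × Fin N,
        lambertDir (G.sepVec (freeFlight G (freeExitTime G ε q.1).toReal q.1 p.1).1
          (freeFlight G (freeExitTime G ε q.1).toReal q.1 p.2).1) q.2 = 0} := by
    intro w
    filter_upwards [ae_stdGaussian_forall_lambertDir_ne_zero (G := G)
      (freeFlight G (freeExitTime G ε w).toReal w)] with ξ h
    simp only [not_exists]
    exact fun p => h p
  filter_upwards [ae_lambertNoise_forall_stateAfter_notMem hG hGm
    (measurableSet_degenerateRedraw hG hGm) hnull z] with ξs h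
  intro k p
  have hk := h k
  simp only [not_exists] at hk
  exact hk p

/-- **Conservation of the kinetic energy along the Lambertian recursion, almost surely**
(fixed datum, regular measurable geometry, dimension `≥ 2`). [folklore] -/
theorem ae_lambertNoise_forall_configEnergy_lambertStateAfter (hG : G.IsHardSphereRegular ε)
    (hGm : G.IsMeasurable) (z : Config N d X) :
    ∀ᵐ ξs ∂(lambertNoise d), ∀ k, configEnergy (lambertStateAfter G ε ξs z k) = configEnergy z := by
  filter_upwards [ae_lambertNoise_forall_lambertDir_ne_zero hG hGm z] with ξs h
  intro k
  induction k with
  | zero => rfl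
  | succ k ih =>
    rw [lambertStateAfter_succ, configEnergy_lambertStep (ξs k) _ fun p _ => h k p, ih]

/-- **Conservation of the kinetic energy along the Lambertian flow, almost surely, at all
times** (fixed datum, regular measurable geometry, dimension `≥ 2`). [folklore] -/
theorem ae_lambertNoise_forall_configEnergy_lambertFlow (hG : G.IsHardSphereRegular ε)
    (hGm : G.IsMeasurable) (z : Config N d X) :
    ∀ᵐ ξs ∂(lambertNoise d), ∀ t, configEnergy (lambertFlow G ε ξs z t) = configEnergy z := by
  filter_upwards [ae_lambertNoise_forall_configEnergy_lambertStateAfter hG hGm z] with ξs h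
  intro t
  rw [lambertFlow, configEnergy_freeFlight]
  exact h _

end Recursion

/-! ## The torus, and the fixed-reduced-density scaling -/

section Torus

variable {d : Type*} [Fintype d] [Nontrivial d] {N : ℕ}

/-- On `T^d`, `d ≥ 2`, `ε < 1/2`: for every datum, all redraws of the Lambertian recursion are
non-degenerate `lambertNoise`-almost surely, hence the kinetic energy is conserved along the
Lambertian flow at all times, almost surely. [folklore] -/
theorem ae_lambertNoise_forall_configEnergy_lambertFlow_torus {ε : ℝ} (hε : ε < 2⁻¹)
    (z : Config N d (UnitAddTorus d)) :
    ∀ᵐ ξs ∂(lambertNoise d), ∀ t,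
      configEnergy (lambertFlow (Torus.geometry d) ε ξs z t) = configEnergy z :=
  ae_lambertNoise_forall_configEnergy_lambertFlow (Torus.isHardSphereRegular_geometry hε)
    Torus.isMeasurable_geometry z

/-- The hydrodynamic-limit scaling: `N + 1` spheres of diameter `hsDiameter σ N` on `𝕋³`,
`0 ≤ σ < 1/2` — along the Lambertian flow of the route items the kinetic energy is conserved at
all times, for every datum and `lambertNoise`-a.e. noise. [folklore] -/
theorem ae_lambertNoise_forall_configEnergy_lambertFlow_hsDiameter {σ : ℝ} (hσ : 0 ≤ σ)
    (hσ' : σ < 2⁻¹) (N : ℕ) (z : Config (N + 1) (Fin 3) (UnitAddTorus (Fin 3))) :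
    ∀ᵐ ξs ∂(lambertNoise (Fin 3)), ∀ t,
      configEnergy (lambertFlow (Torus.geometry (Fin 3)) (hsDiameter σ N) ξs z t) =
        configEnergy z :=
  ae_lambertNoise_forall_configEnergy_lambertFlow_torus ((hsDiameter_le hσ N).trans_lt hσ') z

end Torus

end Literature.MathematicalPhysics.KineticTheory
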